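import Literature.MathematicalPhysics.QuantumFieldTheory.Balaban1983to89.B1Eq324BenfattoClassSectEMemberERowsAtNode00Star
import Literature.MathematicalPhysics.QuantumFieldTheory.Balaban1983to89.Node00.OpsYSectEElimStarSmall

/-!
# `Balaban1983to89.B1Eq324BenfattoClassSectEMemberERowsAtNode00StarSmall` — THE PIVOT-INVERSE ROW AND THE COLUMN MASS OF NODE 00's STAR `C_st(V)`
# IN THE SMALL-FIELD REGIME: T. Bałaban, *Propagators for lattice gauge theories in a background field*, Commun. Math. Phys. **99** (1985) 389–434
# [Balaban1985BackgroundPropagators], Sect. E (3.157) p. 428 with (3.35) p. 396, in the STAR convention of [4] (2.3) ∕ Lemma 2.4 p. 245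
# [Balaban1984PropagatorsII]; [5] (125)–(126) p. 36 [Balaban1985Averaging] (seat dag-n08-d g39; the `…_of_small ∕ _of_smallVY` rows that
# `B1Eq324BenfattoClassSectEMemberERowsAtNode00Star`'s HONEST SCOPE names as «NOT ported here (they need the star twins of `OpsYSectEElimSmall`'s
# `norm_KY_sub_le ∕ isUnit_KY_of_small`)» — those twins are `Node00.OpsYSectEElimStarSmall`)

statement-level companion of published sources with citation tags; every declaration here is a theorem; nothing here is a claim about the
Yang–Mills mass gap

Print, p. 428 (3.157): *«(CB)(b₀) is equal to a solution of the equation (QB)(c) = 0 considered as an equation on the variable B(b₀)»*; [5] (126) p. 36: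
`|(Q(V₀)A)_c| ≤ (1 + O(1)L²α₀)α₁`; [4] Lemma 2.4 p. 245: «Λ also a set of bonds b such that at least one of the end-points b₋, b₊ belongs to Λ».

WHY THIS FILE.  `B1Eq324BenfattoClassSectEMemberERowsAtNode00Star` (dag-n08-b g37) proved the `E`-rows of the (3.24) precision door at the STAR letter
`C_st(V) = Node00.OpsYSectEElimStar.elimCstY` — LOCALITY at every background, and COLUMN MASS `Σ_u ‖(C_st(V)(δ_q ⊗ w))(u)‖ ≤ (1 + κ_K)‖w‖` MODULO a star
pivot-inverse row `hK : ∀ c a, ‖K_c(V)⁻¹a‖ ≤ κ_K·L^{d+1}·‖a‖` (`sum_norm_elimCstY_single_le_of_contract ∕ …_le`, `colMass_elimCΛstY_ofRecordTC[_of_contract]`),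
discharging `hK` at `U = 1` only (`norm_inverse_KstY_one_apply_le`, `κ_K = 1`).  `Node00.OpsYSectEElimStarSmall` (this seat) proved the star pivot
coefficients near-scalar and units for SMALL FIELDS (`norm_KstY_sub_le`: `‖L^{d+1}K_c(V)a − a‖ ≤ κ‖a‖`, `κ := L^{d+1}·2δ(L + (d+1)ℓ) < 1`;
`isUnit_KstY_of_small`).  THIS FILE supplies the row `hK` in that regime — `‖K_c(V)⁻¹a‖ ≤ (1 − κ)⁻¹·L^{d+1}·‖a‖` (the norm companion
`norm_inverse_apply_le_of_norm_smul_sub_le` of the Neumann lemma, from `B1Eq324BenfattoClassSectEMemberERowsAtNode00` §1, BY NAME) — and composes: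
the column mass of `C_st(V)` and the door's row `hmass` at the seven-letter STAR record and at the v7 star record, for every small `V`, with
`κ_K := (1 − κ)⁻¹`.  The SOURCE-convention twins are `B1Eq324BenfattoClassSectEMemberERowsAtNode00` §4 (`norm_inverse_KY_apply_le_of_small ∕ _of_smallVY`,
`sum_norm_elimCY_single_le_of_smallVY`, `colMass_elimCΛY_ofRecordTC_of_smallVY`, `colMass_elimC_sectEYOfRecordV6_of_smallVY`); the proofs are theirs under
`KY ↦ KstY`, `CBondY ↦ CBondStY`, `elimCY ↦ elimCstY`, v6 ↦ v7.

WHAT IS PROVED (member `x`, averaged-field parameter `𝔳`, star corners `c : CBondStY x`):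
* §1 ★★ `norm_inverse_KstY_apply_le_of_small` — THE STAR PIVOT-INVERSE ROW FOR SMALL FIELDS, `‖K_c(V)⁻¹a‖ ≤ (1 − κ)⁻¹L^{d+1}‖a‖` at EVERY star corner;
  `norm_inverse_KstY_apply_le_of_smallVY` (packaged `SmallVY x 𝔳 G U δ`); ★★ `sum_norm_elimCstY_single_le_of_smallVY` — COLUMN MASS of `C_st(V)`,
  `≤ (1 + (1 − κ)⁻¹)‖w‖`, no `IsUnit` ∕ inverse-row hypothesis left.
* §2 ★★ `colMass_elimCΛstY_ofRecordTC_of_smallVY` — the door's row `hmass` at the STAR record letters `sectELettersStYOfRecordTC x 𝔳 𝔢₀`,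
  `m := (1 + (1 − κ)⁻¹)·n_e`.
* §3 RECORD LEVEL (v7 star letters `sectEStYOfRecordV7`, fibre `M_N(ℂ)`, `G ≤ U(N)`): ★★ `colMass_elimC_sectEStYOfRecordV7_of_smallVY` and
  `colMass_elimC_sectEStYOfRecordV7_of_small` (the `SmallVY` witness from `Node00.OpsYSectEElimSmall.smallVY_avYOfRecord`).

HONEST SCOPE.  Count-neutral Literature theorems (compositions by name; the one estimate is the generic inverse bound applied to `norm_KstY_sub_le`);
print's regime (3.35) is small CURVATURE — the small-curvature ∕ gauge-orbit ∕ `plaqSmall` rows of the source file's §7 are NOT ported (their engine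
`Q1Y_ugauge` asks the source block good; see `Node00.OpsYSectEElimStarSmall` margin (i)); constants cruder than print's (`d, L` only); no door assembled;
nothing of [Balaban1985BackgroundPropagators] ∕ [Balaban1985Averaging] ∕ [Balaban1984PropagatorsII] is asserted beyond what the tree proves; node N06 ∕ N08
NOT discharged; nothing about the continuum, OS axioms, a mass gap or Clay.
-/

noncomputable section

open Finset

namespace Literature.MathematicalPhysics.QuantumFieldTheory.Balaban1983to89.B1Eq324BenfattoClassSectEMemberERowsAtNode00StarSmall

open Literature.MathematicalPhysics.QuantumFieldTheory
open Literature.MathematicalPhysics.QuantumFieldTheory.Balaban1983to89.B9PinMembersKLevelV1 (MemberY)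
open Literature.MathematicalPhysics.QuantumFieldTheory.Balaban1983to89.Node00
open Literature.MathematicalPhysics.QuantumFieldTheory.Balaban1983to89.B1Eq324BenfattoClassSectEMemberERowsAtNode00
  (norm_inverse_apply_le_of_norm_smul_sub_le)
open Literature.MathematicalPhysics.QuantumFieldTheory.Balaban1983to89.B1Eq324BenfattoClassSectEMemberERowsAtNode00Star
  (sum_norm_elimCstY_single_le colMass_elimCΛstY_ofRecordTC)
open B7Prop2Explicit (unitaryUnits)

variable {d ℓ : ℕ} {hd : 1 ≤ d + 1} {hL : Odd (ℓ + 1) ∧ 1 < ℓ + 1} {w₀ w₁ : ℝ} {Mstar : ℕ}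

/-! ## §1  The star pivot-inverse row for small fields; the column mass of `C_st(V)` with no hypothesis left -/

section PivotInverse

variable {𝔸 : Type} [NormedRing 𝔸] [NormedAlgebra ℂ 𝔸] [CompleteSpace 𝔸]
variable (x : MemberY d ℓ hd hL w₀ w₁ Mstar) (𝔳 : AvY 𝔸 x)

/-- ★★ **THE STAR PIVOT-INVERSE ROW FOR SMALL FIELDS**: under the small-field hypotheses (`G`-valued contracting `V`, `‖V(b) − 1‖ ≤ δ`,
`κ := L^{d+1}·2δ(L + (d+1)ℓ) < 1`) `‖K_c(V)⁻¹a‖ ≤ (1 − κ)⁻¹·L^{d+1}·‖a‖` at EVERY star corner — `Node00.OpsYSectEElimStarSmall.norm_KstY_sub_le`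
(`‖L^{d+1}K_c(V)a − a‖ ≤ κ‖a‖`), the unit property `isUnit_KstY_of_small`, and the generic inverse bound; this is the binder `hK` of
`B1Eq324BenfattoClassSectEMemberERowsAtNode00Star.sum_norm_elimCstY_single_le[_of_contract]` with `κ_K := (1 − κ)⁻¹`.
[cite: Balaban1985BackgroundPropagators, (3.35) p.396, p.428; Balaban1985Averaging, (125)–(126) p.36; Balaban1984PropagatorsII, Lemma 2.4 p.245] -/
theorem norm_inverse_KstY_apply_le_of_small {G : Subgroup 𝔸ˣ} (hG1 : ∀ g ∈ G, ‖((g : 𝔸ˣ) : 𝔸)‖ ≤ 1) {U : CfgY 𝔸 x.toKIdx} (h𝔳 : ∀ b, 𝔳 U b ∈ G)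
    {δ : ℝ} (hδ0 : 0 ≤ δ) (hδ : ∀ b, ‖((𝔳 U b : 𝔸ˣ) : 𝔸) - 1‖ ≤ δ)
    (hsmall : (((ℓ + 1 : ℕ) : ℝ)) ^ (d + 1) * (2 * δ * (((ℓ + 1 : ℕ) + (d + 1) * ℓ : ℕ) : ℝ)) < 1) (c : CBondStY x) (a : 𝔸) :
    ‖Ring.inverse (KstY x 𝔳 U c) a‖ ≤
      (1 - (((ℓ + 1 : ℕ) : ℝ)) ^ (d + 1) * (2 * δ * (((ℓ + 1 : ℕ) + (d + 1) * ℓ : ℕ) : ℝ)))⁻¹ * (((ℓ + 1 : ℕ) : ℝ)) ^ (d + 1) * ‖a‖ := by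
  have hLp0 : ((((ℓ + 1 : ℕ) : ℂ)) ^ (d + 1)) ≠ 0 := pow_ne_zero _ (Nat.cast_ne_zero.2 (Nat.succ_ne_zero ℓ))
  have hLpn : ‖(((ℓ + 1 : ℕ) : ℂ)) ^ (d + 1)‖ = (((ℓ + 1 : ℕ) : ℝ)) ^ (d + 1) := by rw [norm_pow, Complex.norm_natCast]
  have hdev : ∀ a : 𝔸, ‖((((ℓ + 1 : ℕ) : ℂ)) ^ (d + 1) • KstY x 𝔳 U c) a - a‖ ≤
      (((ℓ + 1 : ℕ) : ℝ)) ^ (d + 1) * (2 * δ * (((ℓ + 1 : ℕ) + (d + 1) * ℓ : ℕ) : ℝ)) * ‖a‖ := by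
    intro a
    have e : ((((ℓ + 1 : ℕ) : ℂ)) ^ (d + 1) • KstY x 𝔳 U c) a - a =
        (((ℓ + 1 : ℕ) : ℂ)) ^ (d + 1) • (KstY x 𝔳 U c a - ((((ℓ + 1 : ℕ) : ℂ)) ^ (d + 1))⁻¹ • a) := by
      rw [LinearMap.smul_apply, smul_sub, smul_inv_smul₀ hLp0]
    rw [e, norm_smul, hLpn, mul_assoc]
    exact mul_le_mul_of_nonneg_left (by simpa only [mul_assoc] using norm_KstY_sub_le x 𝔳 hG1 h𝔳 hδ0 hδ c a) (by positivity)
  have h := norm_inverse_apply_le_of_norm_smul_sub_le (KstY x 𝔳 U c) (isUnit_KstY_of_small x 𝔳 hG1 h𝔳 hδ0 hδ hsmall c) hsmall hdev a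
  rw [hLpn, div_eq_mul_inv, mul_comm ((((ℓ + 1 : ℕ) : ℝ)) ^ (d + 1))] at h
  exact h

/-- the star pivot-inverse row in the packaged small-field regime `SmallVY x 𝔳 G U δ`. [cite: Balaban1985BackgroundPropagators, (3.35) p.396, p.428, bookkeeping] -/
theorem norm_inverse_KstY_apply_le_of_smallVY {G : Subgroup 𝔸ˣ} {U : CfgY 𝔸 x.toKIdx} {δ : ℝ} (h : SmallVY x 𝔳 G U δ) (c : CBondStY x) (a : 𝔸) :
    ‖Ring.inverse (KstY x 𝔳 U c) a‖ ≤
      (1 - (((ℓ + 1 : ℕ) : ℝ)) ^ (d + 1) * (2 * δ * (((ℓ + 1 : ℕ) + (d + 1) * ℓ : ℕ) : ℝ)))⁻¹ * (((ℓ + 1 : ℕ) : ℝ)) ^ (d + 1) * ‖a‖ :=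
  norm_inverse_KstY_apply_le_of_small x 𝔳 h.1 h.2.1 h.2.2.1 h.2.2.2.1 h.2.2.2.2 c a

/-- ★★ **COLUMN MASS OF THE STAR `C_st(V)` IN THE SMALL-FIELD REGIME**: `Σ_u ‖(C_st(V)(δ_q ⊗ w))(u)‖ ≤ (1 + (1 − κ)⁻¹)·‖w‖` under `SmallVY x 𝔳 G U δ`
(`κ := L^{d+1}·2δ(L + (d+1)ℓ)`) — dag-n08-b's `sum_norm_elimCstY_single_le` with its inverse-row binder discharged.
[cite: Balaban1985BackgroundPropagators, (3.157) p.428, (3.35) p.396; Balaban1985Averaging, (125)–(126) p.36; Balaban1984PropagatorsII, Lemma 2.4 p.245] -/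
theorem sum_norm_elimCstY_single_le_of_smallVY [DecidableEq (IBondY x.toKIdx)] {G : Subgroup 𝔸ˣ} {U : CfgY 𝔸 x.toKIdx} {δ : ℝ}
    (h : SmallVY x 𝔳 G U δ) (q : IBondY x.toKIdx) (w : 𝔸) :
    ∑ u, ‖elimCstY x 𝔳 U (Pi.single q w) u‖ ≤
      (1 + (1 - (((ℓ + 1 : ℕ) : ℝ)) ^ (d + 1) * (2 * δ * (((ℓ + 1 : ℕ) + (d + 1) * ℓ : ℕ) : ℝ)))⁻¹) * ‖w‖ :=
  sum_norm_elimCstY_single_le x 𝔳 h.1 h.2.1 (inv_nonneg.2 (sub_nonneg.2 h.2.2.2.2.le)) (norm_inverse_KstY_apply_le_of_smallVY x 𝔳 h) q w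

end PivotInverse

/-! ## §2  The door's row `hmass` at the seven-letter STAR record `sectELettersStYOfRecordTC x 𝔳 𝔢₀` in the small-field regime -/

section Door

variable {𝔸 : Type} [NormedRing 𝔸] [NormedAlgebra ℂ 𝔸] [CompleteSpace 𝔸]
variable (x : MemberY d ℓ hd hL w₀ w₁ Mstar) (𝔳 : AvY 𝔸 x)

/-- ★★ **ROW `hmass` AT THE STAR RECORD LETTERS IN THE SMALL-FIELD REGIME**: `m := (1 + (1 − κ)⁻¹)·n_e` under `SmallVY x 𝔳 G U δ`, for a family
`b : κ → 𝔸` with `‖b c′‖ ≤ n_e` (dag-n08-b's `colMass_elimCΛstY_ofRecordTC` with its inverse-row binder discharged).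
[cite: Balaban1985BackgroundPropagators, (3.157) p.428, (3.35) p.396; Balaban1985UV3, (24) p.262] -/
theorem colMass_elimCΛstY_ofRecordTC_of_smallVY [DecidableEq (IBondY x.toKIdx)] (𝔢₀ : SectELettersY 𝔸 x) {G : Subgroup 𝔸ˣ}
    {U : CfgY 𝔸 x.toKIdx} {δ : ℝ} (h : SmallVY x 𝔳 G U δ) {κ : Type} (b : κ → 𝔸) {ne : ℝ} (hne : ∀ c', ‖b c'‖ ≤ ne) {σ : Type}
    (ι : σ → IBondY x.toKIdx) :
    ∀ (s : σ) (c' : κ), ∑ u, ‖elimCΛstY x (sectELettersStYOfRecordTC x 𝔳 𝔢₀) U (Pi.single (ι s) (b c')) u‖ ≤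
      (1 + (1 - (((ℓ + 1 : ℕ) : ℝ)) ^ (d + 1) * (2 * δ * (((ℓ + 1 : ℕ) + (d + 1) * ℓ : ℕ) : ℝ)))⁻¹) * ne :=
  colMass_elimCΛstY_ofRecordTC x 𝔳 𝔢₀ h.1 h.2.1 (inv_nonneg.2 (sub_nonneg.2 h.2.2.2.2.le)) (norm_inverse_KstY_apply_le_of_smallVY x 𝔳 h) b hne ι

end Door

/-! ## §3  Record level: the row `hmass` at the v7 STAR Sect. E letters `sectEStYOfRecordV7` (fibre `M_N(ℂ)`, `G ≤ U(N)`) -/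

section RecordV7

open scoped Matrix.Norms.L2Operator

variable (N : ℕ) (θ : Stage3Params) (M₆ : ℕ) (𝔢₀ : SectEY N θ M₆)

/-- ★★ **ROW `hmass` AT THE v7 STAR RECORD IN THE SMALL-FIELD REGIME OF RECORD** (`SmallVY x (avYOfRecord x) G U δ`): `m := (1 + (1 − κ)⁻¹)·n_e`.
[cite: Balaban1985BackgroundPropagators, (3.157) p.428, (3.35) p.396, (3.40) p.397; Balaban1985UV3, (24) p.262] -/
theorem colMass_elimC_sectEStYOfRecordV7_of_smallVY (x : MemberY θ.d₆ θ.ℓ₆ θ.hd' θ.hL' θ.b₀ θ.b₁ M₆) [DecidableEq (IBondY x.toKIdx)]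
    {G : Subgroup (Matrix (Fin N) (Fin N) ℂ)ˣ} {U : CfgY (Matrix (Fin N) (Fin N) ℂ) x.toKIdx} {δ : ℝ} (h : SmallVY x (avYOfRecord x) G U δ)
    {κ : Type} (b : κ → Matrix (Fin N) (Fin N) ℂ) {ne : ℝ} (hne : ∀ c', ‖b c'‖ ≤ ne) {σ : Type} (ι : σ → IBondY x.toKIdx) :
    ∀ (s : σ) (c' : κ), ∑ u, ‖elimCΛstY x (sectEStYOfRecordV7 N θ M₆ 𝔢₀ x) U (Pi.single (ι s) (b c')) u‖ ≤
      (1 + (1 - (((θ.ℓ₆ + 1 : ℕ) : ℝ)) ^ (θ.d₆ + 1) * (2 * δ * (((θ.ℓ₆ + 1 : ℕ) + (θ.d₆ + 1) * θ.ℓ₆ : ℕ) : ℝ)))⁻¹) * ne :=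
  colMass_elimCΛstY_ofRecordTC_of_smallVY x (avYOfRecord x) (𝔢₀ x) h b hne ι

/-- ★★ **… FOR A `G`-VALUED BACKGROUND WITH SMALL AVERAGED FIELD OF RECORD** (`G ≤ U(N)`, `‖avYOfRecord x U b − 1‖ ≤ δ`, smallness; the `SmallVY` witness
is `Node00.OpsYSectEElimSmall.smallVY_avYOfRecord`). [cite: Balaban1985BackgroundPropagators, (3.157) p.428, (3.35) p.396, (3.40) p.397; Balaban1985UV3, (24) p.262] -/
theorem colMass_elimC_sectEStYOfRecordV7_of_small (x : MemberY θ.d₆ θ.ℓ₆ θ.hd' θ.hL' θ.b₀ θ.b₁ M₆) [DecidableEq (IBondY x.toKIdx)]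
    {G : Subgroup (Matrix (Fin N) (Fin N) ℂ)ˣ} (hG : G ≤ unitaryUnits (Matrix (Fin N) (Fin N) ℂ)) {U : CfgY (Matrix (Fin N) (Fin N) ℂ) x.toKIdx}
    (hU : ∀ μ z, U μ z ∈ G) {δ : ℝ} (hδ0 : 0 ≤ δ)
    (hδ : ∀ b, ‖((avYOfRecord x U b : (Matrix (Fin N) (Fin N) ℂ)ˣ) : Matrix (Fin N) (Fin N) ℂ) - 1‖ ≤ δ)
    (hsmall : (((θ.ℓ₆ + 1 : ℕ) : ℝ)) ^ (θ.d₆ + 1) * (2 * δ * (((θ.ℓ₆ + 1 : ℕ) + (θ.d₆ + 1) * θ.ℓ₆ : ℕ) : ℝ)) < 1)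
    {κ : Type} (b : κ → Matrix (Fin N) (Fin N) ℂ) {ne : ℝ} (hne : ∀ c', ‖b c'‖ ≤ ne) {σ : Type} (ι : σ → IBondY x.toKIdx) :
    ∀ (s : σ) (c' : κ), ∑ u, ‖elimCΛstY x (sectEStYOfRecordV7 N θ M₆ 𝔢₀ x) U (Pi.single (ι s) (b c')) u‖ ≤
      (1 + (1 - (((θ.ℓ₆ + 1 : ℕ) : ℝ)) ^ (θ.d₆ + 1) * (2 * δ * (((θ.ℓ₆ + 1 : ℕ) + (θ.d₆ + 1) * θ.ℓ₆ : ℕ) : ℝ)))⁻¹) * ne :=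
  colMass_elimC_sectEStYOfRecordV7_of_smallVY N θ M₆ 𝔢₀ x (smallVY_avYOfRecord N θ M₆ x hG hU hδ0 hδ hsmall) b hne ι

end RecordV7

end Literature.MathematicalPhysics.QuantumFieldTheory.Balaban1983to89.B1Eq324BenfattoClassSectEMemberERowsAtNode00StarSmall

end
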